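import Literature.NumberTheory.DiophantineGeometry.GeneralizedFermatTwoPowerCoefficientAssemblyProofs
import Literature.NumberTheory.GaloisRepresentations.FramedRepBaseChange
import HarnessLib

/-!
# Ribet 1997, Theorem 3 along Serre's road: the good-reduction places need no hypothesis (proofs)

Topic `Literature/NumberTheory/DiophantineGeometry`; sixth sibling *proofs* file (theorems only:
no definition, no named fact, no `sorry`) of `GeneralizedFermatTwoPowerCoefficient` (named fact
`ribet1997_twoPowerFermat`: K. Ribet, *On the equation `aᵖ + 2^α bᵖ + cᵖ = 0`*, Acta Arith. 79
(1997), Thm. 3).  The sibling `…AssemblyProofs` proved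
`ribet1997_twoPowerFermat_of_khare_wintenberger_of_mazurKenku_of_tate`: Theorem 3 from the three
named facts `khare_wintenberger`, `mazurKenku_exists_cyclic_isogeny`,
`artinConductorExponent_tate_eq_conductorExponent_of_isElliptic` and two printed local statements
taken as hypotheses — `hwt` (Serre 1987, §2.9 Prop. 5 / (4.1.11): weight `2`) and `hTate` (Serre
1987, (4.1.12): a *semistable* `ℓ ≠ p` with `p ∣ ord_ℓ Δ_min` does not divide `N(ρ̄_{E,p})`).

Serre's (4.1.12) combines two local facts: at a prime of **good** reduction `E[p]` is unramified
(criterion of Néron–Ogg–Shafarevich, Silverman *AEC* VII.4.1 — a theorem of the tree,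
`IsTorsionGaloisRep.isUnramifiedAt_of_hasGoodReductionAt`), and at a prime of **multiplicative**
reduction `E[p]` is unramified iff `p ∣ v_ℓ(Δ_min)` (the Tate curve: Serre 1972, n° 1.12; Serre
1987, §2.9; Diamond–Darmon–Taylor, Prop. 2.12(c) — not in the tree).  This file proves the
good-reduction half inside the tree and re-assembles Theorem 3 with `hTate` restricted to the
multiplicative places, so that the remaining hypothesis is exactly the printed Tate-curve statement:

* `not_dvd_serreLevel_of_artinConductorExponent_eq_zero` — `a_v(ρ̄) = 0 ⇒ ℓ_v ∤ N(ρ̄)` (Serre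
  1987, §1.2);
* `not_dvd_serreLevel_baseChange_of_hasGoodReductionAt` (places of `𝓞 ℚ`) and
  `not_dvd_serreLevel_baseChange_of_hasGoodReductionAt_int` (places of `ℤ`) — **a prime `ℓ ≠ p` of
  good reduction does not divide `N(ρ̄_{E,p} ⊗ k)`**;
* `ribet1997_twoPowerFermat_of_khare_wintenberger_of_mazurKenku_of_tateCurve` — Theorem 3 from the
  three named facts, `hwt`, and the Tate-curve criterion at multiplicative `ℓ ≠ p`.

After this file the discharge `ribet1997_twoPowerFermat_holds` is the last theorem applied to
`khare_wintenberger_holds`, `mazurKenku_exists_cyclic_isogeny_holds`,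
`artinConductorExponent_tate_eq_conductorExponent_of_isElliptic_holds` (none in the tree: SIZE XL,
XL, L) and to discharges of the two printed local statements of Serre 1987 (§2.9 Prop. 5; the Tate
curve at `ℓ ≠ p`), which are not catalogued as named facts (a provefact seat may not add them,
D-0026; statements ready in the shape of `hwt`/`hTate`).

## References

* [Ribet1997] K. A. Ribet, Acta Arith. 79 (1997), 7–16, Thm. 3, §§2–3.
* [Serre1987] J.-P. Serre, Duke Math. J. 54 (1987): §1.2 ((1.2.1)–(1.2.2)), §2.9 Prop. 5, §4.1
  (4.1.11)–(4.1.12).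
* [Serre1972] J.-P. Serre, Invent. Math. 15 (1972), n° 1.12 (courbes de Tate).
* [DarmonDiamondTaylor1995] H. Darmon, F. Diamond, R. Taylor, *Fermat's Last Theorem*, Prop. 2.12.
* [SilvermanAEC2009] J. H. Silverman, *The Arithmetic of Elliptic Curves*, 2nd ed., Prop. VII.4.1,
  VII.5 Prop. 5.1.
-/

noncomputable section

open scoped NumberField
open IsDedekindDomain Rat.HeightOneSpectrum

namespace Literature.NumberTheory.DiophantineGeometry

open WeierstrassCurve GaloisRepresentations EllipticCurves GaloisRepresentations.ModPGaloisRep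
  GaloisRepresentations.IsNonarchimedeanLocalField ValuativeRel IsDedekindDomain.HeightOneSpectrum
  Literature.NumberTheory.Automorphic Literature.NumberTheory.Automorphic.BCDT

/-- **A place with conductor exponent `0` does not divide Serre's level.**  For a mod `p`
representation `ρ̄ : Γ_ℚ → GL₂(k)` and a finite place `v` of `ℚ` with `a_v(ρ̄) = 0`, the prime
`ℓ_v` under `v` does not divide `N(ρ̄) = ∏_{ℓ ≠ p} ℓ^{a_ℓ(ρ̄)}` (Serre 1987, §1.2, (1.2.1)–(1.2.2):
`N(ρ̄)` is the product over the primes `ℓ ≠ p` at which `ρ̄` is ramified).  (If the product is not a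
finite one, `serreLevel` is the junk value `1`.) [cite: Serre1987, §1.2, (1.2.1)–(1.2.2)] -/
theorem not_dvd_serreLevel_of_artinConductorExponent_eq_zero {k : Type*} [Field k]
    [TopologicalSpace k] [IsTopologicalRing k] (p : ℕ) [Fact p.Prime] (ρ : ModPGaloisRep ℚ k 2)
    (v : HeightOneSpectrum (𝓞 ℚ))
    (h0 : (FramedGaloisRep.toGaloisRep ρ).artinConductorExponent v = 0) :
    ¬ ((primesEquiv v : Nat.Primes) : ℕ) ∣ serreLevel p ρ := by
  classical
  have hℓ : ((primesEquiv v : Nat.Primes) : ℕ).Prime := (primesEquiv v).2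
  set f : HeightOneSpectrum (𝓞 ℚ) → ℕ := fun w ↦
    if ((primesEquiv w : Nat.Primes) : ℕ) = p then 1
    else ((primesEquiv w : Nat.Primes) : ℕ) ^ (FramedGaloisRep.toGaloisRep ρ).artinConductorExponent w
    with hf
  have hS : serreLevel p ρ = ∏ᶠ w, f w := rfl
  intro hdvd
  rw [hS] at hdvd
  by_cases hfin : (Function.mulSupport f).Finite
  · rw [finprod_eq_prod f hfin] at hdvd
    obtain ⟨w, hw, hdw⟩ := (Nat.prime_iff.mp hℓ).exists_mem_finset_dvd hdvd
    rw [Set.Finite.mem_toFinset, Function.mem_mulSupport] at hw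
    by_cases hwp : ((primesEquiv w : Nat.Primes) : ℕ) = p
    · exact hw (by rw [hf]; exact if_pos hwp)
    · have hdw' : ((primesEquiv v : Nat.Primes) : ℕ) ∣
          ((primesEquiv w : Nat.Primes) : ℕ) ^ (FramedGaloisRep.toGaloisRep ρ).artinConductorExponent w := by
        rw [hf] at hdw
        simpa [hwp] using hdw
      have heq : ((primesEquiv v : Nat.Primes) : ℕ) = (primesEquiv w : Nat.Primes) :=
        (Nat.prime_dvd_prime_iff_eq hℓ (primesEquiv w).2).mp (hℓ.dvd_of_dvd_pow hdw')
      have hvw : v = w := (primesEquiv (R := 𝓞 ℚ)).injective (Subtype.ext heq)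
      subst hvw
      apply hw
      rw [hf]
      simp only [hwp, if_false, h0, pow_zero]
  · rw [finprod_of_infinite_mulSupport hfin] at hdvd
    exact hℓ.one_lt.ne' (Nat.dvd_one.mp hdvd)

/-- **Néron–Ogg–Shafarevich for Serre's level: a prime `ℓ ≠ p` of good reduction does not divide
`N(ρ̄_{E,p} ⊗ k)`.**  For an elliptic curve `W/ℚ`, a prime `p`, a framed model `ρ̄` of `E[p]`
(`IsTorsionGaloisRep`), a ring homomorphism `j : 𝔽_p → k` to a topological field and a finite place
`v ∤ p` of `ℚ` at which `W` has good reduction, `ℓ_v ∤ N(ρ̄ ⊗_j k)`: `E[p]` is unramified at `v`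
(Silverman, *AEC*, VII.4.1; the tree's `IsTorsionGaloisRep.isUnramifiedAt_of_hasGoodReductionAt`),
so is `ρ̄ ⊗ k` (`isUnramifiedAt_baseChange_iff`), hence `a_v(ρ̄ ⊗ k) = 0`
(`artinConductorExponent_eq_zero_of_isUnramifiedAt_holds`, Serre, *Local Fields*, VI §2) and
`ℓ_v ∤ N` (`not_dvd_serreLevel_of_artinConductorExponent_eq_zero`).  This is the good-reduction half
of Serre 1987, (4.1.12). [cite: Serre1987, §4.1 (4.1.12)] [cite: SilvermanAEC2009, Prop. VII.4.1(a)] -/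
theorem not_dvd_serreLevel_baseChange_of_hasGoodReductionAt (W : WeierstrassCurve ℚ) [W.IsElliptic]
    (p : ℕ) [Fact p.Prime] {ρ : ModPGaloisRep ℚ (ZMod p) 2} (hρ : W.IsTorsionGaloisRep p ρ)
    {k : Type*} [Field k] [TopologicalSpace k] [IsTopologicalRing k] (j : ZMod p →+* k)
    (hj : Continuous j) (v : HeightOneSpectrum (𝓞 ℚ))
    (hvp : ((primesEquiv v : Nat.Primes) : ℕ) ≠ p) (hgood : W.HasGoodReductionAt v) :
    ¬ ((primesEquiv v : Nat.Primes) : ℕ) ∣ serreLevel p (FramedRep.baseChange j hj ρ) := by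
  have hp : p.Prime := Fact.out
  have hn : ((p : ℕ) : 𝓞 ℚ) ∉ v.asIdeal :=
    fun h ↦ hvp ((natCast_mem_asIdeal_iff_primesEquiv_eq v hp).mp h)
  have hunr : FramedGaloisRep.IsUnramifiedAt v ρ := hρ.isUnramifiedAt_of_hasGoodReductionAt hgood hn
  have hunr' : FramedGaloisRep.IsUnramifiedAt v (FramedRep.baseChange j hj ρ) :=
    (FramedGaloisRep.isUnramifiedAt_baseChange_iff j hj j.injective v ρ).mpr hunr
  have h0 := GaloisRep.artinConductorExponent_eq_zero_of_isUnramifiedAt_holds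
    ((FramedGaloisRep.isUnramifiedAt_toGaloisRep_iff v _).mpr hunr')
  exact not_dvd_serreLevel_of_artinConductorExponent_eq_zero p _ v h0

/-- The same over the places of `ℤ` (the indexing used by `WeierstrassCurve.IsSemistableAt`,
`ordMinimalDiscriminant` over `ℤ ⊆ ℚ`): for a finite place `v` of `ℤ` above a prime `ℓ ≠ p` of good
reduction, `ℓ ∤ N(ρ̄_{E,p} ⊗ k)`.  The two good-reduction predicates are compared through the
prime-indexed `HasGoodReductionAtPrime ℓ` (`hasGoodReductionAtPrime_iff_hasGoodReductionAt_holds`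
for `ℤ`, `hasGoodReductionAtPrime_iff_hasGoodReductionAt_ringOfIntegers` for `𝓞 ℚ`; Silverman,
*AEC*, VII.5 Prop. 5.1(a)). [cite: Serre1987, §4.1 (4.1.12)] [cite: SilvermanAEC2009, Prop. VII.4.1(a)] -/
theorem not_dvd_serreLevel_baseChange_of_hasGoodReductionAt_int (W : WeierstrassCurve ℚ)
    [W.IsElliptic] (p : ℕ) [Fact p.Prime] {ρ : ModPGaloisRep ℚ (ZMod p) 2}
    (hρ : W.IsTorsionGaloisRep p ρ) {k : Type*} [Field k] [TopologicalSpace k]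
    [IsTopologicalRing k] (j : ZMod p →+* k) (hj : Continuous j) (v : HeightOneSpectrum ℤ)
    (hvp : natGenerator v ≠ p) (hgood : W.HasGoodReductionAt v) :
    ¬ natGenerator v ∣ serreLevel p (FramedRep.baseChange j hj ρ) := by
  -- `ℓ = natGenerator v`, the place `v' = primesEquiv.symm ℓ` of `𝓞 ℚ`
  set ℓ : Nat.Primes := primesEquiv (R := ℤ) v with hℓ_def
  have hℓv : (ℓ : ℕ) = natGenerator v := rfl
  haveI : Fact (ℓ : ℕ).Prime := ⟨ℓ.2⟩
  set v' : HeightOneSpectrum (𝓞 ℚ) := (primesEquiv (R := 𝓞 ℚ)).symm ℓ with hv'_def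
  have hℓv' : (primesEquiv (R := 𝓞 ℚ) v' : Nat.Primes) = ℓ := by
    rw [hv'_def, Equiv.apply_symm_apply]
  -- good reduction at `v` ⇒ at the prime `ℓ` ⇒ at `v'`
  have h1 : W.HasGoodReductionAtPrime (ℓ : ℕ) := by
    have h := hasGoodReductionAtPrime_iff_hasGoodReductionAt_holds W ℓ
    rw [hℓ_def, Equiv.symm_apply_apply] at h
    exact h.mpr hgood
  have h2 : W.HasGoodReductionAt v' := by
    have h := hasGoodReductionAtPrime_iff_hasGoodReductionAt_ringOfIntegers v' W
    rw [hℓv'] at h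
    exact h.mp h1
  have h3 := not_dvd_serreLevel_baseChange_of_hasGoodReductionAt W p hρ j hj v'
    (by rw [hℓv', hℓv]; exact hvp) h2
  rwa [hℓv', hℓv] at h3

/-- **Ribet 1997, Theorem 3, from `khare_wintenberger`, `mazurKenku_exists_cyclic_isogeny`, the
exponentwise Ogg–Saito fact, Serre's Prop. 5 (§2.9) and the Tate-curve criterion at the
multiplicative primes only.**  This is
`ribet1997_twoPowerFermat_of_khare_wintenberger_of_mazurKenku_of_tate` with its hypothesis `hTate`
(Serre 1987, (4.1.12), at every *semistable* `ℓ ≠ p` with `p ∣ ord_ℓ Δ_min`) weakened to the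
places of **multiplicative** reduction, i.e. to the printed local statement about Tate curves —
Serre, Invent. Math. 15 (1972), n° 1.12 / Serre 1987, §2.9 ("on utilise le modèle de Tate"):
*for `E/ℚ_ℓ` with multiplicative reduction and `p ≠ ℓ`, `E[p]` is unramified iff `p ∣ v_ℓ(Δ_min)`*
(Diamond–Darmon–Taylor, *Fermat's Last Theorem*, Prop. 2.12(c)); the good-reduction places are
handled inside the tree by Néron–Ogg–Shafarevich
(`not_dvd_serreLevel_baseChange_of_hasGoodReductionAt_int`).  Remaining hypotheses: `hKW` (named
fact `khare_wintenberger`), `hMK` (named fact `mazurKenku_exists_cyclic_isogeny`), `hOS` (named fact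
`artinConductorExponent_tate_eq_conductorExponent_of_isElliptic`), `hwt` (Serre 1987, §2.9 Prop. 5
with (4.1.11): weight `2` at a semistable `p ≥ 5` with `p ∣ ord_p Δ_min`) and `hTate` (the Tate-curve
criterion just quoted). [cite: Ribet1997, Thm. 3, §§2–3] [cite: Serre1987, §2.9 Prop. 5, §4.1 (4.1.11)–(4.1.12)]
[cite: Serre1972, n° 1.12] [cite: DarmonDiamondTaylor1995, Prop. 2.12] -/
theorem ribet1997_twoPowerFermat_of_khare_wintenberger_of_mazurKenku_of_tateCurve
    (hKW : ∀ (p : ℕ) [Fact p.Prime] (k : Type) [Field k] [TopologicalSpace k] [DiscreteTopology k],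
      khare_wintenberger p k)
    (hMK : mazurKenku_exists_cyclic_isogeny)
    (hOS : ∀ (W : WeierstrassCurve ℚ) (ℓ : ℕ) [Fact ℓ.Prime],
      W.artinConductorExponent_tate_eq_conductorExponent_of_isElliptic ℓ)
    (hwt : ∀ (W : WeierstrassCurve ℚ) [W.IsElliptic] (p : ℕ) [Fact p.Prime], 5 ≤ p →
      W.IsSemistableAt ((primesEquiv (R := ℤ)).symm ⟨p, Fact.out⟩) →
      p ∣ W.ordMinimalDiscriminant ((primesEquiv (R := ℤ)).symm ⟨p, Fact.out⟩) →
      ∀ ρ : ModPGaloisRep ℚ (ZMod p) 2, W.IsTorsionGaloisRep p ρ →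
        ∀ (k : Type) [Field k] [TopologicalSpace k] [DiscreteTopology k] [CharP k p]
          [IsAlgClosed k] (j : ZMod p →+* k)
          (loc : LocalRestrictionAt p (FramedRep.baseChange j continuous_of_discreteTopology ρ))
          (ι : absIntegers 𝒪[loc.F] loc.F ⧸ absMaximalIdeal loc.F →+* k),
          serreWeight p (FramedRep.baseChange j continuous_of_discreteTopology ρ) loc ι = 2)
    (hTate : ∀ (W : WeierstrassCurve ℚ) [W.IsElliptic] (p : ℕ) [Fact p.Prime],
      ∀ ρ : ModPGaloisRep ℚ (ZMod p) 2, W.IsTorsionGaloisRep p ρ →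
        ∀ (k : Type) [Field k] [TopologicalSpace k] [DiscreteTopology k] [CharP k p]
          [IsAlgClosed k] (j : ZMod p →+* k) (v : HeightOneSpectrum ℤ),
          natGenerator v ≠ p → W.HasMultiplicativeReductionAt v → p ∣ W.ordMinimalDiscriminant v →
            ¬ natGenerator v ∣ serreLevel p (FramedRep.baseChange j continuous_of_discreteTopology ρ)) :
    ribet1997_twoPowerFermat := by
  refine ribet1997_twoPowerFermat_of_khare_wintenberger_of_mazurKenku_of_tate hKW hMK hOS hwt ?_
  intro W _ p _ ρ hρ k _ _ _ _ _ j v hvp hsemi hord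
  rcases hsemi with hgood | hmult
  · exact not_dvd_serreLevel_baseChange_of_hasGoodReductionAt_int W p hρ j _ v hvp hgood
  · exact hTate W p ρ hρ k j v hvp hmult hord

end Literature.NumberTheory.DiophantineGeometry
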